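import Literature.AlgebraicGeometry.Motives.FrobeniusGalois
import HarnessLib

/-!
# `ℚ_ℓ`-coefficients: `Hⁱ(X_{k̄}, ℚ_ℓ) = ℚ_ℓ ⊗_{ℤ_ℓ} lim_m Hⁱ((X_{k̄})_ét, ℤ/ℓᵐ)`, its Galois
# representation, functorial pull-backs, and `F^* = ρ(F_geom)` (Deligne, Weil I (1.3), (1.15))

`EllAdicEtalePullback.lean` and `FrobeniusGalois.lean` give, on the integral `ℓ`-adic étale
cohomology `lim_m Hⁱ(–_ét, ℤ/ℓᵐ)` (`towerLim`, with its canonical `ℤ_ℓ`-module structure), the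
pull-backs, the Galois action of a `k`-scheme and Deligne's dictionary `F^* = ρ(φ⁻¹)`, all as
additive maps. This file makes them **`ℤ_ℓ`-linear** and passes to **`ℚ_ℓ`-coefficients** by base
change `ℚ_ℓ ⊗_{ℤ_ℓ} –` (Milne V §1: "`Hʳ(X, ℚ_l) = Hʳ(X, ℤ_l) ⊗ ℚ_l`"; Deligne (1.3)), which is the
setting of the tree's `GaloisWeilCohomology k ℚ_[ℓ] χ` (`GaloisRealization.lean`):

* `ellAdicEtaleCohomologyPullbackLinear ℓ f i` (`ℤ_ℓ`-linear `f^*`, functorial),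
  `geometricEllAdicEtaleCohomologyRepInt ℓ X i : Representation ℤ_[ℓ] Γ_k (lim_m Hⁱ((X_{k̄})_ét, ℤ/ℓᵐ))`;
* `ellAdicEtaleCohomologyRat ℓ i Y = ℚ_[ℓ] ⊗[ℤ_[ℓ]] lim_m Hⁱ(Y_ét, ℤ/ℓᵐ)`, the `ℚ_ℓ`-linear pull-back
  `ellAdicEtaleCohomologyRatPullback` (functorial: `_comp`, `_id`), and
  **`geometricEllAdicEtaleCohomologyRepRat ℓ X i : Representation ℚ_[ℓ] Γ_k (Hⁱ(X_{k̄}, ℚ_ℓ))`**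
  (Mathlib `Module.End.baseChangeHom`), with Galois-equivariance of pull-backs
  (`geometricEllAdicEtaleCohomologyRepRat_pullback`, the shape of `GaloisWeilCohomology.pullback_ρ`);
* **`ellAdicEtaleCohomologyRatPullback_frobenius_eq_geomFrob`**: over a finite field,
  `(F_{X/k} × 1)^* = ρ(geomFrob k)` on `Hⁱ(X_{k̄}, ℚ_ℓ)` (Deligne (1.15.1) "`F^* = F`"), i.e. the
  hypothesis (D) of `hasLefschetzTraceFormula_of_frobeniusOver` (`LefschetzTraceFormula.lean`) for
  this `Hⁱ`.

## References

* P. Deligne, *La conjecture de Weil. I*, Publ. Math. IHÉS 43 (1974), (1.3) p. 274, (1.15),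
  (1.15.1) p. 279. [Deligne1974]
* J. S. Milne, *Étale cohomology* (reissue 2025), V §1 p. 176, III Rem. 1.6 (c). [Milne2025]

## Design notes

* `ℚ_ℓ ⊗_{ℤ_ℓ}` is Mathlib's `TensorProduct` over `PadicInt`; no finiteness is used or claimed
  here (finite-dimensionality of `Hⁱ(X_{k̄}, ℚ_ℓ)` for smooth proper `X` is the business of the
  `EllAdicCohomologyFiniteness*` files).
* What is NOT here: cup products, trace, cycle classes, Poincaré duality, Künneth — the
  remaining data of a `GaloisWeilCohomology`.
-/

universe u

open CategoryTheory CategoryTheory.Limits AlgebraicGeometry Opposite TensorProduct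

namespace Literature.AlgebraicGeometry.Motives

variable (ℓ : ℕ) [Fact ℓ.Prime]

/-! ### `ℤ_ℓ`-linear versions -/

section Int

variable {X Y Z : Scheme.{u}} (f : X ⟶ Y) (g : Y ⟶ Z) (i : ℕ)

/-- The pull-back on `lim_m Hⁱ(–_ét, ℤ/ℓᵐ)` as a **`ℤ_ℓ`-linear map** (`towerLim.mapLinear`).
[cite: Milne2025, V §1 (p. 176)] -/
noncomputable def ellAdicEtaleCohomologyPullbackLinear :
    towerLim (etaleCohomologyZModPowMap Y ℓ i) →ₗ[ℤ_[ℓ]] towerLim (etaleCohomologyZModPowMap X ℓ i) :=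
  towerLim.mapLinear ℓ (fun m => etaleCohomologyZModPowPullback f ℓ i m)
    (fun m x => etaleCohomologyZModPowMap_pullback f ℓ i m x)

/-- The `ℤ_ℓ`-linear pull-back is `ellAdicEtaleCohomologyPullback` as a function. [folklore] -/
@[simp]
theorem ellAdicEtaleCohomologyPullbackLinear_apply (a : towerLim (etaleCohomologyZModPowMap Y ℓ i)) :
    ellAdicEtaleCohomologyPullbackLinear ℓ f i a = ellAdicEtaleCohomologyPullback f ℓ i a :=
  rfl

/-- `(g f)^* = f^* ∘ g^*` as `ℤ_ℓ`-linear maps. [cite: Milne2025, III Remark 1.6 (c)] -/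
theorem ellAdicEtaleCohomologyPullbackLinear_comp :
    ellAdicEtaleCohomologyPullbackLinear ℓ (f ≫ g) i =
      ellAdicEtaleCohomologyPullbackLinear ℓ f i ∘ₗ ellAdicEtaleCohomologyPullbackLinear ℓ g i :=
  LinearMap.ext fun a => ellAdicEtaleCohomologyPullback_comp f ℓ g i a

/-- `(𝟙)^* = id` as a `ℤ_ℓ`-linear map. [cite: Milne2025, III Remark 1.6 (c)] -/
theorem ellAdicEtaleCohomologyPullbackLinear_id :
    ellAdicEtaleCohomologyPullbackLinear ℓ (𝟙 X) i = LinearMap.id :=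
  LinearMap.ext fun a => ellAdicEtaleCohomologyPullback_id ℓ i a

end Int

section Galois

variable {k : Type u} [Field k] (X : SchemeOver k) (i : ℕ)

/-- The `ℓ`-adic Galois representation on `lim_m Hⁱ((X_{k̄})_ét, ℤ/ℓᵐ)` as a **`ℤ_ℓ`-linear
representation** (`Representation ℤ_ℓ Γ_k`). [cite: Deligne1974, (1.15)] -/
noncomputable def geometricEllAdicEtaleCohomologyRepInt :
    Representation ℤ_[ℓ] (Field.absoluteGaloisGroup k)
      (towerLim (etaleCohomologyZModPowMap (geometricFibre k X) ℓ i)) where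
  toFun g := ellAdicEtaleCohomologyPullbackLinear ℓ (geometricFibreMap X g) i
  map_one' := LinearMap.ext fun a =>
    congrArg (fun φ : AddMonoid.End _ => φ a) (geometricEllAdicEtaleCohomologyRep X ℓ i).map_one
  map_mul' g h := LinearMap.ext fun a =>
    congrArg (fun φ : AddMonoid.End _ => φ a) ((geometricEllAdicEtaleCohomologyRep X ℓ i).map_mul g h)

/-- The `ℤ_ℓ`-linear representation is `geometricEllAdicEtaleCohomologyRep` as a function.
[folklore] -/
@[simp]
theorem geometricEllAdicEtaleCohomologyRepInt_apply (g : Field.absoluteGaloisGroup k)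
    (a : towerLim (etaleCohomologyZModPowMap (geometricFibre k X) ℓ i)) :
    geometricEllAdicEtaleCohomologyRepInt ℓ X i g a = geometricEllAdicEtaleCohomologyRep X ℓ i g a :=
  rfl

end Galois

/-! ### `ℚ_ℓ`-coefficients: `Hⁱ(X) := ℚ_ℓ ⊗_{ℤ_ℓ} lim_m Hⁱ((X_{k̄})_ét, ℤ/ℓᵐ)` -/

section Rat

variable {X Y Z : Scheme.{u}} (f : X ⟶ Y) (g : Y ⟶ Z) (i : ℕ)

/-- **Rational `ℓ`-adic étale cohomology** `Hⁱ(Y_ét, ℚ_ℓ) := ℚ_ℓ ⊗_{ℤ_ℓ} lim_m Hⁱ(Y_ét, ℤ/ℓᵐ)`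
(Milne V §1: "`Hʳ(X, ℚ_l) = Hʳ(X, ℤ_l) ⊗ ℚ_l`"; Deligne, Weil I (1.3)). [cite: Milne2025, V §1 (p. 176)] -/
abbrev ellAdicEtaleCohomologyRat (Y : Scheme.{u}) : Type u :=
  ℚ_[ℓ] ⊗[ℤ_[ℓ]] towerLim (etaleCohomologyZModPowMap Y ℓ i)

/-- The pull-back on `Hⁱ(–_ét, ℚ_ℓ)` (base change of the `ℤ_ℓ`-linear pull-back). [folklore] -/
noncomputable def ellAdicEtaleCohomologyRatPullback :
    ellAdicEtaleCohomologyRat ℓ i Y →ₗ[ℚ_[ℓ]] ellAdicEtaleCohomologyRat ℓ i X :=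
  (ellAdicEtaleCohomologyPullbackLinear ℓ f i).baseChange ℚ_[ℓ]

/-- `(g f)^* = f^* ∘ g^*` on `Hⁱ(–_ét, ℚ_ℓ)`. [cite: Milne2025, III Remark 1.6 (c)] -/
theorem ellAdicEtaleCohomologyRatPullback_comp :
    ellAdicEtaleCohomologyRatPullback ℓ (f ≫ g) i =
      ellAdicEtaleCohomologyRatPullback ℓ f i ∘ₗ ellAdicEtaleCohomologyRatPullback ℓ g i := by
  rw [ellAdicEtaleCohomologyRatPullback, ellAdicEtaleCohomologyPullbackLinear_comp,
    LinearMap.baseChange_comp]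
  rfl

/-- `(𝟙)^* = id` on `Hⁱ(–_ét, ℚ_ℓ)`. [cite: Milne2025, III Remark 1.6 (c)] -/
theorem ellAdicEtaleCohomologyRatPullback_id :
    ellAdicEtaleCohomologyRatPullback ℓ (𝟙 X) i = LinearMap.id := by
  rw [ellAdicEtaleCohomologyRatPullback, ellAdicEtaleCohomologyPullbackLinear_id,
    LinearMap.baseChange_id]

end Rat

section RatGalois

variable {k : Type u} [Field k] (X : SchemeOver k) (i : ℕ)

/-- **The `ℚ_ℓ`-linear Galois representation `Hⁱ(X_{k̄}, ℚ_ℓ)`** of a `k`-scheme: base change to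
`ℚ_ℓ` of the `ℤ_ℓ`-linear one (Deligne, Weil I (1.15)). [cite: Deligne1974, (1.15)] -/
noncomputable def geometricEllAdicEtaleCohomologyRepRat :
    Representation ℚ_[ℓ] (Field.absoluteGaloisGroup k)
      (ellAdicEtaleCohomologyRat ℓ i (geometricFibre k X)) :=
  (Module.End.baseChangeHom ℤ_[ℓ] ℚ_[ℓ] _).toMonoidHom.comp
    (geometricEllAdicEtaleCohomologyRepInt ℓ X i)

/-- `ρ_ℚ(g)` is the base change of `ρ_ℤ(g)` (by `rfl`). [folklore] -/
theorem geometricEllAdicEtaleCohomologyRepRat_apply (g : Field.absoluteGaloisGroup k) :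
    geometricEllAdicEtaleCohomologyRepRat ℓ X i g =
      (geometricEllAdicEtaleCohomologyRepInt ℓ X i g).baseChange ℚ_[ℓ] :=
  rfl

variable {X} in
/-- Pull-backs along `k`-morphisms are Galois equivariant on `Hⁱ(–, ℚ_ℓ)` (the shape of the axiom
`GaloisWeilCohomology.pullback_ρ`). [folklore] -/
theorem geometricEllAdicEtaleCohomologyRepRat_pullback {X' : SchemeOver k} (φ : X ⟶ X')
    (g : Field.absoluteGaloisGroup k) :
    geometricEllAdicEtaleCohomologyRepRat ℓ X i g ∘ₗ
        ellAdicEtaleCohomologyRatPullback ℓ (geometricFibreHom φ) i =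
      ellAdicEtaleCohomologyRatPullback ℓ (geometricFibreHom φ) i ∘ₗ
        geometricEllAdicEtaleCohomologyRepRat ℓ X' i g := by
  rw [geometricEllAdicEtaleCohomologyRepRat_apply, geometricEllAdicEtaleCohomologyRepRat_apply,
    ellAdicEtaleCohomologyRatPullback, ← LinearMap.baseChange_comp, ← LinearMap.baseChange_comp]
  exact congrArg (LinearMap.baseChange ℚ_[ℓ]) (LinearMap.ext fun a => Subtype.ext <| funext fun m =>
    geometricEtaleCohomologyRep_pullback (zmodPowAb.{u} ℓ m) i φ g (a.1 m))

variable [Finite k]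

/-- **Deligne (1.15.1) with `ℚ_ℓ`-coefficients**: on `Hⁱ(X_{k̄}, ℚ_ℓ)` the pull-back along the
`k`-Frobenius `F_{X/k} × 1` is the action of the geometric Frobenius, `F^* = ρ(geomFrob k)`.
[cite: Deligne1974, (1.15.1)] -/
theorem ellAdicEtaleCohomologyRatPullback_frobenius_eq_geomFrob :
    ellAdicEtaleCohomologyRatPullback ℓ (geometricFibreHom (frobeniusOver X)) i =
      geometricEllAdicEtaleCohomologyRepRat ℓ X i (geomFrob k) := by
  rw [geometricEllAdicEtaleCohomologyRepRat_apply, ellAdicEtaleCohomologyRatPullback]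
  exact congrArg (LinearMap.baseChange ℚ_[ℓ])
    (LinearMap.ext fun a => ellAdicEtaleCohomologyPullback_frobenius_eq_geomFrob X i ℓ a)

end RatGalois

end Literature.AlgebraicGeometry.Motives
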